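import Literature.AlgebraicGeometry.Frobenioids.ArithmeticFrobenioidFrobeniusCompact
import Literature.AlgebraicGeometry.Frobenioids.ArithmeticFrobenioidsProofs
import Literature.AlgebraicGeometry.Frobenioids.ArithmeticDivisorsMonoidIsoPlaces
import Literature.AlgebraicGeometry.Frobenioids.ModelFrobenioidRationalFunctionsProofs
import Literature.AlgebraicGeometry.Frobenioids.BaseSectionsOfObjectsCor57NonVacuity
import HarnessLib

/-!
# Frobenioids I, Theorem 6.4 (iv): the transport datum of an equivalence `Ψ : C₁ ⥲ C₂` of arithmetic
# Frobenioids AT THE CONSTRUCTIONS `C_i = C_{K_i/F_i}` (sub-DAG row T64iv/L01)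

Mochizuki, *The geometry of Frobenioids I: the general theory*, Kyushu J. Math. **62** (2008) 293–400, §6,
Thm. 6.4 (iv) p. 115 l. 17–29 ("If the equivalence of categories `Ψ^rlf` of (ii) arises from an equivalence of
categories `Ψ : C₁ ⥲ C₂` [cf. (i); (iii); Theorem 3.4, (iii), (iv)], then … the corresponding [i.e., via the
equivalence `D₁ ⥲ D₂` induced by `Ψ` — cf. (i); Corollary 4.11, (ii)] finite extension `L₂ ⊆ F̃₂` of `F₂` …"),
proof p. 116 l. 17–29 ("`deg^arith_{L_i}` maps a generator of the monoid `Φ_i(L_i)_{v_i} (≅ ℤ_{≥0})` to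
`log(p)`") [cite: MochizukiFrdI2008, Thm. 6.4 (iv) p.115].

PROOF-ONLY file (cell abc-iut, `plan/L1/SUBDAG-FrdI-Thm64.md` §G row **T64iv/L01** "hypothesis structure
`EquivData`: `Ψ : C₁ ⥲ C₂`, `Ψ^Base` (Cor. 4.11 (ii)), the induced MONOID isos `Φ₁(L₁) ≅ Φ₂(L₂)` (Thm. 4.9 /
Cor. 4.11 (iii) for `Ψ` itself: generator ↦ generator)"; L1-lead R108 (4) row (G); seat abc-iut-L1-d7).  Per
R108 the datum is NOT typed as a structure; its fields are hypotheses / conclusions of THEOREMS at THE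
constructed arithmetic Frobenioids `arithFrobenioid F K` (abc-iut-L6-t10, `ArithmeticFrobenioidModel.lean`;
operations `arithFrobenioidOps F K = (arithModelFrobenioid F K).ops`, divisor monoid `Φ(Spec L) =
Multiplicative (EffArithDivisor L)` literally):
* the standing hypotheses of [FrdI] Cor. 4.11 HOLD at `C_{K/F}` for every equivalence `Ψ` — the tree's
  `cor411Setting_arith` (`BaseSectionsOfObjectsCor57NonVacuity.lean`) — and `arith_isOfRationallyStandardType` — `C_{K/F}` is of rationally
  standard type at THE `R`-datum (`Thm64i_frobenioid_rsParams`, abc-iut-L6-t10): so the typed conclusions of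
  Cor. 4.11 (ii)/(iii)/(iv) (abc-iut-L1-t3's `PreFrobenioidData.Cor411ii/iii/iv`, cone nodes FrdI:Cor4.11(ii)–(iv),
  INPUTS BY NAME — binders `h411ii`, `h411iv`) apply to `Ψ` with no further premise;
* `exists_transport_of_cor411iv` — **the transport datum**: from `h411iv`, `Ψ^Base : D₁ ⥤ D₂` (an
  equivalence), `η : Base₂ ∘ Ψ ≅ Ψ^Base ∘ Base₁`, `Ψ^Φ` natural monoid isomorphisms `Φ₁(X) ⥲ Φ₂(Ψ^Base X)`,
  Frobenius degrees preserved, `Div(Ψ φ) = η_A^* Ψ^Φ(Div φ)`, and — the load-bearing clause, from the pure monoid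
  algebra of `ArithmeticDivisorsMonoidIsoPlaces.lean` — for every `X = Spec L₁` a bijection of FINITE places
  `π_X : V(L₁)^non ≃ V(L₂)^non`, `L₂ :=` the field of `Ψ^Base X`, with `Ψ^Φ_X(δ_w) = δ_{π_X w}`
  (**generator ↦ generator**); with `h411ii` the square is `1`-unique (`OneUniqueSquare`, the hypothesis shape of
  abc-iut-L1-t3's schema `Thm64iv`) for THIS `Ψ^Base` (`oneUniqueSquare_of_cor411ii_of_iso`);
* `div_map_stdDen` — Div-transport at generators: the pre-step `(1, id, δ_w, 1)` into an object over `X` goes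
  to an arrow of `C₂` with zero divisor `η^* δ_{π_X w}`.
Row T64iv/L07b (compatibility with an isomorphism `F₁ ≅ F₂`) is GAP-LEDGER G-L1t3-1 and is not touched; the
composition T64iv/L08 (with the degree datum of (ii) and the residue characteristics of (iii)) is a separate file.
No definitions, no named facts; nothing here bears on [IUTchIII] Cor. 3.12 or asserts anything about abc.
-/

noncomputable section

namespace Literature.AlgebraicGeometry.Frobenioids

open CategoryTheory Opposite NumberField
open PreFrobenioidData (OneUniqueSquare)

universe u₁ v₁ u₂ v₂ u₃ v₃ u₄ v₄

/-! ### A `1`-unique square stays `1`-unique after replacing the bottom functor by an isomorphic one -/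

/-- If `B₀` fits a `1`-UNIQUE `1`-commutative square over `T` and `B` merely `1`-commutes (and is an
equivalence), then `B ≅ B₀` and the square for `B` is `1`-unique as well. [cite: MochizukiFrdI2008, Cor. 4.11 (ii) p.91] -/
theorem oneUniqueSquare_of_oneCommutes {X₁ : Type u₁} [Category.{v₁} X₁] {X₂ : Type u₂} [Category.{v₂} X₂]
    {Y₁ : Type u₃} [Category.{v₃} Y₁] {Y₂ : Type u₄} [Category.{v₄} Y₂]
    {T : X₁ ⥤ X₂} {L : X₁ ⥤ Y₁} {R : X₂ ⥤ Y₂} {B₀ B : Y₁ ⥤ Y₂}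
    (h₀ : OneUniqueSquare T L R B₀) (hB : B.IsEquivalence) (hc : OneCommutes T R L B) :
    OneUniqueSquare T L R B := by
  obtain ⟨-, -, huniq⟩ := h₀
  obtain ⟨e⟩ := huniq B hc
  exact ⟨hB, hc, fun B' hB' => (huniq B' hB').map fun e' => e' ≪≫ e.symm⟩

section Arith

variable (F₁ : Type) [Field F₁] [NumberField F₁] (K₁ : Type) [Field K₁] [Algebra F₁ K₁] [IsGalois F₁ K₁]
variable (F₂ : Type) [Field F₂] [NumberField F₂] (K₂ : Type) [Field K₂] [Algebra F₂ K₂] [IsGalois F₂ K₂]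

/-! ### The hypotheses of Cor. 4.11 hold at `C_{K/F}` -/

omit [IsGalois F₁ K₁] in
/-- **`C_{K/F}` is of rationally standard type at THE `R`-datum** (Thm. 6.4 (i), middle conjunct of
abc-iut-L6-t10's `Thm64i_frobenioid_rsParams`: Def. 4.5 (iii) with `C^birat`, `(C^un-tr)^birat` THE
birationalizations and `Supp` the primary support). [cite: MochizukiFrdI2008, Thm. 6.4 (i) p.114] -/
theorem arith_isOfRationallyStandardType [IsGalois F₁ K₁] :
    (arithFrobenioidOps F₁ K₁).IsOfRationallyStandardType
      (PreFrobenioid.rsParams (arithFrobenioid_isFrobenioid F₁ K₁) fun a 𝔭 => PrimarySupp a 𝔭) :=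
  (Thm64i_frobenioid_rsParams F₁ K₁).2.1

variable {F₁ K₁ F₂ K₂}

/-! ### The transport datum of `Ψ` from Cor. 4.11 (iv) at the constructions -/

/-- **T64iv/L01 — the transport datum of an equivalence `Ψ : C_{K₁/F₁} ⥲ C_{K₂/F₂}`** (Thm. 6.4 (iv) p. 115
"[cf. (i); (iii); Theorem 3.4, (iii), (iv)] … via the equivalence `D₁ ⥲ D₂` induced by `Ψ` — cf. (i); Corollary
4.11, (ii)"; proof p. 116 "generator of the monoid `Φ_i(L_i)_{v_i} (≅ ℤ_{≥0})`"): GIVEN the typed conclusion of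
[FrdI] Cor. 4.11 (iv) for `Ψ` at THE `R`-data (binder `h411iv`, cone node FrdI:Cor4.11(iv) — its premises hold
here by `cor411Setting_arith`, `arith_isOfRationallyStandardType`), there are `Ψ^Base : D₁ ⥤ D₂` (an
equivalence), the `Ψ^Φ`-isomorphisms `E`, `η : Base₂ ∘ Ψ ≅ Ψ^Base ∘ Base₁` and, for every `X = Spec L₁ ∈ Ob(D₁)`,
a bijection `π_X` between the FINITE places of `L₁` and of the field `L₂` of `Ψ^Base X` such that:
Frobenius degrees are preserved; `Ψ^Φ_X` maps THE GENERATOR `δ_w` of `Φ₁(L₁)_w ≅ ℤ_{≥0}` to THE GENERATOR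
`δ_{π_X w}`; and `Div(Ψ φ) = η_A^* Ψ^Φ(Div φ)` for every arrow `φ` of `C₁`.
[cite: MochizukiFrdI2008, Thm. 6.4 (iv) p.115] -/
theorem exists_transport_of_cor411iv (Ψ : arithFrobenioid F₁ K₁ ≌ arithFrobenioid F₂ K₂)
    (h411iv : PreFrobenioidData.Cor411iv (arithFrobenioidOps F₁ K₁) (arithFrobenioidOps F₂ K₂) Ψ
      (PreFrobenioid.rsParams (arithFrobenioid_isFrobenioid F₁ K₁) fun a 𝔭 => PrimarySupp a 𝔭)
      (PreFrobenioid.rsParams (arithFrobenioid_isFrobenioid F₂ K₂) fun a 𝔭 => PrimarySupp a 𝔭)) :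
    ∃ (ΨBase : FinSubextCat F₁ K₁ ⥤ FinSubextCat F₂ K₂)
      (E : PreFrobenioidData.DivisorMonoidIsoOverBase (arithFrobenioidOps F₁ K₁) (arithFrobenioidOps F₂ K₂) ΨBase)
      (η : Ψ.functor ⋙ (arithFrobenioidOps F₂ K₂).base ≅ (arithFrobenioidOps F₁ K₁).base ⋙ ΨBase)
      (π : ∀ X : FinSubextCat F₁ K₁, FinitePlace X.L ≃ FinitePlace (ΨBase.obj X).L),
      ΨBase.IsEquivalence ∧
      PreFrobenioidData.PreservesDegFr (arithFrobenioidOps F₁ K₁) (arithFrobenioidOps F₂ K₂) Ψ ∧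
      (∀ (X : FinSubextCat F₁ K₁) (w : FinitePlace X.L),
        E.iso X (Multiplicative.ofAdd (EffArithDivisor.single X.L (Sum.inr w))) =
          Multiplicative.ofAdd (EffArithDivisor.single (ΨBase.obj X).L (Sum.inr (π X w)))) ∧
      ∀ ⦃A B : arithFrobenioid F₁ K₁⦄ (φ : A ⟶ B),
        (arithFrobenioidOps F₂ K₂).div (Ψ.functor.map φ) =
          (arithFrobenioidOps F₂ K₂).pull (η.hom.app A)
            (E.iso ((arithFrobenioidOps F₁ K₁).base.obj A) ((arithFrobenioidOps F₁ K₁).div φ)) := by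
  obtain ⟨ΨBase, E, η, hEq, hdeg, hdiv, -⟩ :=
    h411iv (cor411Setting_arith F₁ K₁ F₂ K₂ Ψ) (arith_isOfRationallyStandardType F₁ K₁)
      (arith_isOfRationallyStandardType F₂ K₂)
  have hπ := fun X : FinSubextCat F₁ K₁ => EffArithDivisor.exists_finitePlaceEquiv_mulEquiv (E.iso X)
  choose π hπ using hπ
  exact ⟨ΨBase, E, η, π, hEq, hdeg, hπ, hdiv⟩

/-- The same together with the typed conclusion of Cor. 4.11 (ii) (binder `h411ii`): THIS `Ψ^Base` (the one of
the Cor. 4.11 (iv) datum) fits a `1`-UNIQUE `1`-commutative square over `Ψ` — the hypothesis shape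
`PreFrobenioidData.OneUniqueSquare Ψ.functor Base₁ Base₂ Ψ^Base` of abc-iut-L1-t3's schema `Thm64iv` ("the
equivalence `D₁ ⥲ D₂` induced by `Ψ` — cf. Corollary 4.11, (ii)"). [cite: MochizukiFrdI2008, Thm. 6.4 (iv) p.115] -/
theorem oneUniqueSquare_of_cor411ii_of_iso (Ψ : arithFrobenioid F₁ K₁ ≌ arithFrobenioid F₂ K₂)
    (h411ii : PreFrobenioidData.Cor411ii (arithFrobenioidOps F₁ K₁) (arithFrobenioidOps F₂ K₂) Ψ)
    {ΨBase : FinSubextCat F₁ K₁ ⥤ FinSubextCat F₂ K₂} (hB : ΨBase.IsEquivalence)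
    (η : Ψ.functor ⋙ (arithFrobenioidOps F₂ K₂).base ≅ (arithFrobenioidOps F₁ K₁).base ⋙ ΨBase) :
    OneUniqueSquare Ψ.functor (arithFrobenioidOps F₁ K₁).base (arithFrobenioidOps F₂ K₂).base ΨBase := by
  obtain ⟨ΨBase₀, h₀, -⟩ := h411ii (cor411Setting_arith F₁ K₁ F₂ K₂ Ψ)
  exact oneUniqueSquare_of_oneCommutes h₀ hB ⟨η⟩

/-! ### Div-transport at generators -/

omit [IsGalois F₁ K₁] [IsGalois F₂ K₂] in
/-- **"Generator ↦ generator" for arrows** (Thm. 6.4 (iv), proof p. 116 l. 25–29): along the transport datum of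
`exists_transport_of_cor411iv`, the pre-step `(1, id, δ_w, 1)` of `C_{K₁/F₁}` with zero divisor THE GENERATOR
`δ_w` at a finite place `w` of `L₁ = Base(A)` (abc-iut-L1-t2's `ModelFrobenioid.stdDen A δ_w`) is carried by `Ψ`
to an arrow of `C_{K₂/F₂}` whose zero divisor is the pull-back along the base-isomorphism `η_A` of THE GENERATOR
`δ_{π w}` of `Φ₂(L₂)`. [cite: MochizukiFrdI2008, Thm. 6.4 (iv) p.116] -/
theorem div_map_stdDen (Ψ : arithFrobenioid F₁ K₁ ≌ arithFrobenioid F₂ K₂)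
    {ΨBase : FinSubextCat F₁ K₁ ⥤ FinSubextCat F₂ K₂}
    (E : PreFrobenioidData.DivisorMonoidIsoOverBase (arithFrobenioidOps F₁ K₁) (arithFrobenioidOps F₂ K₂) ΨBase)
    (η : Ψ.functor ⋙ (arithFrobenioidOps F₂ K₂).base ≅ (arithFrobenioidOps F₁ K₁).base ⋙ ΨBase)
    (π : ∀ X : FinSubextCat F₁ K₁, FinitePlace X.L ≃ FinitePlace (ΨBase.obj X).L)
    (hπ : ∀ (X : FinSubextCat F₁ K₁) (w : FinitePlace X.L),
      E.iso X (Multiplicative.ofAdd (EffArithDivisor.single X.L (Sum.inr w))) =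
        Multiplicative.ofAdd (EffArithDivisor.single (ΨBase.obj X).L (Sum.inr (π X w))))
    (hdiv : ∀ ⦃A B : arithFrobenioid F₁ K₁⦄ (φ : A ⟶ B),
      (arithFrobenioidOps F₂ K₂).div (Ψ.functor.map φ) =
        (arithFrobenioidOps F₂ K₂).pull (η.hom.app A)
          (E.iso ((arithFrobenioidOps F₁ K₁).base.obj A) ((arithFrobenioidOps F₁ K₁).div φ)))
    (A : arithFrobenioid F₁ K₁) (w : FinitePlace A.base.L) :
    (arithFrobenioidOps F₂ K₂).div
        (Ψ.functor.map (ModelFrobenioid.stdDen A (Multiplicative.ofAdd (EffArithDivisor.single A.base.L (Sum.inr w))))) =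
      (arithFrobenioidOps F₂ K₂).pull
        (η.hom.app (ModelFrobenioid.stdSrc A (Multiplicative.ofAdd (EffArithDivisor.single A.base.L (Sum.inr w)))))
        (Multiplicative.ofAdd (EffArithDivisor.single (ΨBase.obj A.base).L (Sum.inr (π A.base w)))) := by
  rw [hdiv]
  exact congrArg ((arithFrobenioidOps F₂ K₂).pull
    (η.hom.app (ModelFrobenioid.stdSrc A (Multiplicative.ofAdd (EffArithDivisor.single A.base.L (Sum.inr w))))))
    (hπ A.base w)

end Arith

end Literature.AlgebraicGeometry.Frobenioids

end
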